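import Summits.CriticalPhenomena.PercolationContinuityZ3.Theorems.PercNearOneGluingNoHeavyLowerTailForestRayleighCounting
import Summits.CriticalPhenomena.PercolationContinuityZ3.Theorems.PercNearOneGluingNoHeavyLowerTailForestRayleighPosCorr
import HarnessLib

/-!
# Weighted forest negative correlation on graphs of tree-width ≤ 2 — XII: a concrete family (squares of paths ⊇ all cycles)

Sanity instantiation of the elimination-order hypotheses of `forestsW_rayleigh_of_elimOrder`:
on `V = Fin n` with `ρ = Fin.val`, the edge system
`T = {ij : j = i + 1 ∨ j = i + 2}` (the square of the path `0 – 1 – ⋯ – (n-1)`, a 2-tree) satisfies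
them (`pathSq_adj_ne`, `pathSq_two_higher`, `pathSq_fill`). Every cycle `C_m` (`m ≤ n`) embeds in
it (`0,1,3,5,…` up and back down the even vertices), as do paths and triangle strips. Hence,
with no ordering hypothesis left: the Grimmett–Winkler / Kahn negative-correlation inequality for
the uniform spanning forest (`forests_negCorr_pathSq`) and positive correlation of connection
events in the weighted arboreal gas (`forestsW_conn_posCorr_pathSq`) for every edge system inside
the square of a path. Theorems only; no definitions, no `sorry`.
-/

open Finset SimpleGraph

namespace Summit.CriticalPhenomena.PercolationContinuityZ3.Theorems.ForestRayleigh

/-! ### §1 The square of a path is a 2-tree with elimination order `Fin.val` -/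

/-- Membership in the square of the path, unpacked. [elementary] -/
theorem mem_pathSq_iff (n : ℕ) (v u : Fin n) :
    s(v, u) ∈ (Finset.univ.filter fun z : Sym2 (Fin n) =>
        ∃ a b : Fin n, z = s(a, b) ∧ (b.val = a.val + 1 ∨ b.val = a.val + 2)) ↔
      (u.val = v.val + 1 ∨ u.val = v.val + 2) ∨ (v.val = u.val + 1 ∨ v.val = u.val + 2) := by
  simp only [Finset.mem_filter, Finset.mem_univ, true_and]
  constructor
  · rintro ⟨a, b, hab, h⟩
    rcases Sym2.eq_iff.1 hab with ⟨rfl, rfl⟩ | ⟨rfl, rfl⟩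
    · exact Or.inl h
    · exact Or.inr h
  · rintro (h | h)
    · exact ⟨v, u, rfl, h⟩
    · exact ⟨u, v, Sym2.eq_swap, h⟩

/-- Adjacent vertices of the square of a path have different `Fin.val`. [elementary] -/
theorem pathSq_adj_ne (n : ℕ) : ∀ u v : Fin n,
    s(u, v) ∈ (Finset.univ.filter fun z : Sym2 (Fin n) =>
        ∃ a b : Fin n, z = s(a, b) ∧ (b.val = a.val + 1 ∨ b.val = a.val + 2)) →
      (u : ℕ) ≠ (v : ℕ) := by
  intro u v h
  rw [mem_pathSq_iff] at h
  omega

/-- Every vertex of the square of a path has at most two `val`-higher neighbours. [elementary] -/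
theorem pathSq_two_higher (n : ℕ) : ∀ v u₁ u₂ u₃ : Fin n,
    s(v, u₁) ∈ (Finset.univ.filter fun z : Sym2 (Fin n) =>
        ∃ a b : Fin n, z = s(a, b) ∧ (b.val = a.val + 1 ∨ b.val = a.val + 2)) →
    s(v, u₂) ∈ (Finset.univ.filter fun z : Sym2 (Fin n) =>
        ∃ a b : Fin n, z = s(a, b) ∧ (b.val = a.val + 1 ∨ b.val = a.val + 2)) →
    s(v, u₃) ∈ (Finset.univ.filter fun z : Sym2 (Fin n) =>
        ∃ a b : Fin n, z = s(a, b) ∧ (b.val = a.val + 1 ∨ b.val = a.val + 2)) →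
      (v : ℕ) < u₁ → (v : ℕ) < u₂ → (v : ℕ) < u₃ → u₁ = u₂ ∨ u₁ = u₃ ∨ u₂ = u₃ := by
  intro v u₁ u₂ u₃ h₁ h₂ h₃ l₁ l₂ l₃
  rw [mem_pathSq_iff] at h₁ h₂ h₃
  by_cases e12 : (u₁ : ℕ) = u₂
  · exact Or.inl (Fin.ext e12)
  by_cases e13 : (u₁ : ℕ) = u₃
  · exact Or.inr (Or.inl (Fin.ext e13))
  have e23 : (u₂ : ℕ) = u₃ := by omega
  exact Or.inr (Or.inr (Fin.ext e23))

/-- The two `val`-higher neighbours of a vertex of the square of a path are adjacent. [elementary] -/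
theorem pathSq_fill (n : ℕ) : ∀ v u₁ u₂ : Fin n,
    s(v, u₁) ∈ (Finset.univ.filter fun z : Sym2 (Fin n) =>
        ∃ a b : Fin n, z = s(a, b) ∧ (b.val = a.val + 1 ∨ b.val = a.val + 2)) →
    s(v, u₂) ∈ (Finset.univ.filter fun z : Sym2 (Fin n) =>
        ∃ a b : Fin n, z = s(a, b) ∧ (b.val = a.val + 1 ∨ b.val = a.val + 2)) →
      (v : ℕ) < u₁ → (v : ℕ) < u₂ → u₁ ≠ u₂ →
    s(u₁, u₂) ∈ (Finset.univ.filter fun z : Sym2 (Fin n) =>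
        ∃ a b : Fin n, z = s(a, b) ∧ (b.val = a.val + 1 ∨ b.val = a.val + 2)) := by
  intro v u₁ u₂ h₁ h₂ l₁ l₂ hne
  rw [mem_pathSq_iff] at h₁ h₂ ⊢
  have hne' : (u₁ : ℕ) ≠ u₂ := fun h => hne (Fin.ext h)
  omega

/-! ### §2 Hypothesis-free corollaries -/

section Forests
open scoped Classical

/-- **Grimmett–Winkler / Kahn negative correlation for the uniform spanning forest of every graph
inside the square of a path** (in particular every cycle `C_m`): `#{e,f ∈ F}·#F ≤ #{e ∈ F}·#{f ∈ F}`.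
[`forests_negCorr_of_elimOrder` + §1] -/
theorem forests_negCorr_pathSq (n : ℕ) (E : Finset (Sym2 (Fin n)))
    (hE : E ⊆ Finset.univ.filter fun z : Sym2 (Fin n) =>
        ∃ a b : Fin n, z = s(a, b) ∧ (b.val = a.val + 1 ∨ b.val = a.val + 2))
    {e f : Sym2 (Fin n)} (he : e ∈ E) (hf : f ∈ E) (hef : e ≠ f) :
    #(E.powerset.filter fun F : Finset (Sym2 (Fin n)) =>
        (fromEdgeSet ((F : Finset (Sym2 (Fin n))) : Set (Sym2 (Fin n)))).IsAcyclic ∧ e ∈ F ∧ f ∈ F) *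
      #(E.powerset.filter fun F : Finset (Sym2 (Fin n)) =>
        (fromEdgeSet ((F : Finset (Sym2 (Fin n))) : Set (Sym2 (Fin n)))).IsAcyclic) ≤
    #(E.powerset.filter fun F : Finset (Sym2 (Fin n)) =>
        (fromEdgeSet ((F : Finset (Sym2 (Fin n))) : Set (Sym2 (Fin n)))).IsAcyclic ∧ e ∈ F) *
      #(E.powerset.filter fun F : Finset (Sym2 (Fin n)) =>
        (fromEdgeSet ((F : Finset (Sym2 (Fin n))) : Set (Sym2 (Fin n)))).IsAcyclic ∧ f ∈ F) :=
  forests_negCorr_of_elimOrder _ (fun v : Fin n => (v : ℕ)) (pathSq_adj_ne n) (pathSq_two_higher n)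
    (pathSq_fill n) E hE he hf hef

/-- **Positive correlation of connection events in the weighted arboreal gas on every minor of the
square of a path** (in particular on every cycle and its minors), all activities:
`Z[a~b]·Z[c~d] ≤ Z·Z[a~b ∧ c~d]` for `ab, cd` edges of the square (or `a = b`, `c = d`).
[`forestsW_conn_posCorr_of_elimOrder` + §1] -/
theorem forestsW_conn_posCorr_pathSq (n : ℕ) (w : Sym2 (Fin n) → ℝ) (hw : ∀ x, 0 ≤ w x)
    (D K : Finset (Sym2 (Fin n))) (hDK : Disjoint D K)
    (hsub : D ∪ K ⊆ Finset.univ.filter fun z : Sym2 (Fin n) =>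
        ∃ a b : Fin n, z = s(a, b) ∧ (b.val = a.val + 1 ∨ b.val = a.val + 2))
    {a b c d : Fin n}
    (hab : a = b ∨ s(a, b) ∈ Finset.univ.filter fun z : Sym2 (Fin n) =>
        ∃ a b : Fin n, z = s(a, b) ∧ (b.val = a.val + 1 ∨ b.val = a.val + 2))
    (hcd : c = d ∨ s(c, d) ∈ Finset.univ.filter fun z : Sym2 (Fin n) =>
        ∃ a b : Fin n, z = s(a, b) ∧ (b.val = a.val + 1 ∨ b.val = a.val + 2)) :
    (∑ G ∈ D.powerset.filter (fun G =>
        (fromEdgeSet ((G ∪ K : Finset (Sym2 (Fin n))) : Set (Sym2 (Fin n)))).IsAcyclic ∧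
        (fromEdgeSet ((G ∪ K : Finset (Sym2 (Fin n))) : Set (Sym2 (Fin n)))).Reachable a b),
        ∏ x ∈ G, w x) *
      (∑ G ∈ D.powerset.filter (fun G =>
        (fromEdgeSet ((G ∪ K : Finset (Sym2 (Fin n))) : Set (Sym2 (Fin n)))).IsAcyclic ∧
        (fromEdgeSet ((G ∪ K : Finset (Sym2 (Fin n))) : Set (Sym2 (Fin n)))).Reachable c d),
        ∏ x ∈ G, w x) ≤
    (∑ G ∈ D.powerset.filter (fun G =>
        (fromEdgeSet ((G ∪ K : Finset (Sym2 (Fin n))) : Set (Sym2 (Fin n)))).IsAcyclic), ∏ x ∈ G, w x) *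
      (∑ G ∈ D.powerset.filter (fun G =>
        (fromEdgeSet ((G ∪ K : Finset (Sym2 (Fin n))) : Set (Sym2 (Fin n)))).IsAcyclic ∧
        ((fromEdgeSet ((G ∪ K : Finset (Sym2 (Fin n))) : Set (Sym2 (Fin n)))).Reachable a b ∧
         (fromEdgeSet ((G ∪ K : Finset (Sym2 (Fin n))) : Set (Sym2 (Fin n)))).Reachable c d)),
        ∏ x ∈ G, w x) :=
  forestsW_conn_posCorr_of_elimOrder _ (fun v : Fin n => (v : ℕ)) (pathSq_adj_ne n)
    (pathSq_two_higher n) (pathSq_fill n) w hw D K hDK hsub hab hcd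

end Forests

end Summit.CriticalPhenomena.PercolationContinuityZ3.Theorems.ForestRayleigh
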